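import Summits.QuantumFields.BalabanUV.T4Continuum.Support.VariationalColourTaxiTowerEndClass
import Summits.QuantumFields.BalabanUV.T4Continuum.Support.VariationalVectorLandauTower
import Summits.QuantumFields.BalabanUV.T4Continuum.Support.VariationalVectorRegularityNear

/-!
# T⁴ programme, spine node NE2 (U1a), lane P2 — «V-COL-TAXI-END», part 3: THE LANDAU INHABITANT AT BAŁABAN's TAXI DATA — leaf-10-g3's Landau-family END
# `towerLimitRate_effV_of_leaves_landau` (p220989) at the nested product line transports of a COHERENT tower of UNITARY one-step bond operators under the
# scale-invariant plaquette class: EVERY socket inhabited except the two one-step-consistency binders of the gauge functional (`hFED`, `hONE` for the FULL forms —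
# «not expected» for `landauG`, N-ne2leaf01g6-1) and V-REG

NE2 formalisation swarm `b2b-balaban-t4-ne2-formalise-*`, leaf prover 04 GEN 5 (`prover-b2b-balaban-t4-ne2-formalise-leaf-04-g5-0`); register row «P2-sup» of
`t4/formal/NE2/LEAVES.md`; journal CLAIMS.log «V-COL-TAXI-END».  Compositions BY NAME of leaf-10-g3's `VariationalVectorLandauTower.{towerLimitRate_effV_of_leaves_landau,
KLandau_posSemidef, landauG_eq_qform, landauG_hGtr}` (p220989), leaf-09-g6's `VariationalVectorGarding.{landauG_le, qWV_le_of_poincare_divControl, divControl_landauG,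
landauG_nonneg}` (p219068), leaf-03-g5's `VariationalVectorRegularityNear.hREG_rhoV_landau_near` (p224635), parts 1 ∕ 2 of «V-COL-TAXI-END» and parts 5 ∕ 9 ∕ 10 of
«V-COL-TAXI(-TOWER)» ((E_k) `nestLv_sub_lineT_le` p222743); nothing defined.

THE POINT.  For the Landau ∕ penalty functional `G k := landauG δ (Rlev k) = δ⁻¹·Σ_x‖div_{Rlev k} W(x)‖²` the G-side laws that part 1 displays for a general `G` are THEOREMS:
(GF1′) with `C_G = d∕δ`, `C₀ = 0` (`landauG_le`), the Gårding half from (GF3) `divControl_landauG` + part 10's rough Poincaré `qWV_le_nestLv` (A = 64, B = 40) through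
`qWV_le_of_poincare_divControl` (`C_P,k = max(80(1+δ), 64 + 80·64·d((L^k)²a_k))`), the matrix form `KLandau` and the transport identity `landauG_hGtr`.  So at Bałaban's
taxi data under the plaquette class `(L^{k+1})²b_k ≤ c`:
 * §1 `hPc_landau_nestLv` ∕ `hPf_landau_nestLv` (V-P CLOSED for the Landau form on the tower's carriers, both levels), `hUBc_landau_nestLv` ∕ `hUBf_landau_nestLv`
   (V-UB CLOSED, constant `Λ^L_k = lamV d (L^k(d−1)(L^k−1)a_k) (d∕δ) 0 ∕ (1 − κ⁻¹γ_k)²`);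
 * §2 **`towerLimitRate_effV_taxiTower_landau_of_class`**: `TowerLimitRate (fun _ ↦ 1) 1 (k ↦ effV (L^k) M (Rlev k) (KLandau δ (Rlev k)) (QmL (L^k) M (nestLv k)) a)
   (eV Λ⋆ C_P⋆ c_δF + ePV Λ⋆ C_P⋆ C_R⋆ c_ε c_δ′) θ` with `Λ⋆ = 4·lamV d ((d−1)c) (d∕δ) 0`, `C_P⋆ = max(80(1+δ), 64 + 5120·d·c)`, from: `2 ≤ L`, `1 ≤ d`, `1 < M_μ`, `0 < δ`,
   unitary coherent one-step bond data in the class with `c` polynomially small (part 2's three conditions + `80·d·c ≤ 1`), any rate `θ ∈ [0,1)`; DISPLAYED: `hFED k`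
   (full Landau forms, parameter `δF k ≤ c_δF θ^k`), `hONE k` (full fine Landau form, `ε₁`, `δ′`, `ρV`), `hREG k` (`C_R`) — and NOTHING ELSE;
 * §3 **`towerLimitRate_effV_taxiTower_landau_one_of_class`** (`δ = 1`, `ρV k := rhoV (L^k) M (Rlev k)`): `hREG k` DISCHARGED as well by leaf-03-g5's near-line V-REG
   `hREG_rhoV_landau_near` (frames the STRAIGHT level-`k` taxi `taxiTv (L^k) M (Rlev k)` with in-block defect `(d−1)(L^k−1)a_k` in block form, `hnear` := (E_k), V-UB := §1;
   `C_R⋆ = 4Λ⋆ + ½`) — DISPLAYED: ONLY `hFED k` ∕ `hONE k`.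
HONEST, UP FRONT (as p220989): the two displayed Federbush-type binders are NOT expected to be inhabited for `landauG` (one-step consistency (GF2)∕(GF2′) fails for a
divergence penalty under the line average — N-ne2leaf01g6-1, p219068's located remark, leaf-09-g6's design note 14:00Z); what this file settles is that at CURVED data
every OTHER binder of the vector END — structural, transport, V-UB, V-P — is a theorem for a concrete local quadratic gauge functional, so the END's open content at
taxi data is exactly V-GF's one-step consistency (V-REG being discharged at `δ = 1` by leaf-03-g5's (G); at general `δ` it stays displayed only because (G) is stated at `δ = 1`).

HONEST FRAMING (T4-DAG p. 1).  Composition at MODEL level (`E = ℂ`; bond operators DATA; taxi ∕ straight contours OURS; SHAPES only, no B0, c5); Landau is a model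
inhabitant, NOT Bałaban's `G`; nothing printed is a hypothesis; no `def`, no `def … : Prop`, no `sorry`; axioms standard.  V-GF ∕ V-REG OPEN ⟹ V-END NOT proved; NE2 NOT
proved on either road; NE3 OPEN; spine PROVED 0∕9 unchanged; rung (B)+1 finite T⁴ — NOT infinite volume, NOT mass gap, NOT Clay.  HONEST DEPENDENCY (cell, verbatim):
continuum YM on T⁴ ⇐ BetaPertH ∧ nine spine estimates (0/9 proved); BetaPertH ⇐ (D1) ∧ (D4) ∧ CAP+tail; G-an2-4 gates asym, D1 and NE2/3/4.
-/

noncomputable section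

namespace Summit.QuantumFields.BalabanUV.T4Continuum.VariationalColourTaxiTransport

open Finset
open scoped Matrix ComplexOrder BigOperators
open Literature.MathematicalPhysics.QuantumFieldTheory.Balaban1983to89.B5Prop11Plancherel (Tor fine unitVec)
open Literature.Analysis.Complex (qform)
open Summit.QuantumFields.BalabanUV.T4Continuum.VariationalTransfer (blockSpin)
open Summit.QuantumFields.BalabanUV.T4Continuum.VariationalColourFederbush (norm_le_one_of_mem_unitary)
open Summit.QuantumFields.BalabanUV.T4Continuum.VariationalColourTower (Rtrv)
open Summit.QuantumFields.BalabanUV.T4Continuum.VariationalVectorFederbush (lineT)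
open Summit.QuantumFields.BalabanUV.T4Continuum.CovariantAveragingTower (TowerLimitRate)
open Summit.QuantumFields.BalabanUV.T4Continuum.VectorBlockTrialForm (nsqV nsqV_nonneg QvL roughV kappaV compL)
open Summit.QuantumFields.BalabanUV.T4Continuum.VariationalVectorForm (ScV SfV qWV qVV lamV lamV_nonneg ScV_nonneg)
open Summit.QuantumFields.BalabanUV.T4Continuum.VariationalVectorEffective (unc effV)
open Summit.QuantumFields.BalabanUV.T4Continuum.VariationalVectorTower (Gtr QmL ubV_transport SfV_eq_transport)
open Summit.QuantumFields.BalabanUV.T4Continuum.VariationalVectorEndOfLeaves (eV ePV)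
open Summit.QuantumFields.BalabanUV.T4Continuum.VariationalVectorGarding (landauG landauG_le landauG_nonneg qWV_le_of_poincare_divControl divControl_landauG)
open Summit.QuantumFields.BalabanUV.T4Continuum.VariationalVectorLandauTower (KLandau KLandau_posSemidef landauG_eq_qform landauG_hGtr
  towerLimitRate_effV_of_leaves_landau)
open Summit.QuantumFields.BalabanUV.T4Continuum.VariationalVectorOneStepPhys (rhoV rhoV_nonneg)
open Summit.QuantumFields.BalabanUV.T4Continuum.VariationalVectorRegularityNear (hREG_rhoV_landau_near)

variable {d : ℕ}

/-! ## §1 V-P and V-UB CLOSED for the Landau form on the tower's carriers -/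

section Sockets

variable {H : Type*} [NormedAddCommGroup H] [InnerProductSpace ℂ H] [CompleteSpace H] [FiniteDimensional ℂ H]
variable (L : ℕ) [NeZero L] (M : Fin d → ℕ) [hM : ∀ μ, NeZero (M μ)]
variable {R' : (k : ℕ) → Tor (fine L (fine (L ^ k) M)) → Fin d → (H →L[ℂ] H)} (hU : ∀ k x μ, R' k x μ ∈ unitary (H →L[ℂ] H))
variable {b : ℕ → ℝ}
  (hb : ∀ k x κ ι, ‖R' k x κ * R' k (x + unitVec (fine L (fine (L ^ k) M)) κ) ι - R' k x ι * R' k (x + unitVec (fine L (fine (L ^ k) M)) ι) κ‖ ≤ b k)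
variable (hcoh : ∀ k, coarseTv L (fine (L ^ (k + 1)) M) (R' (k + 1)) = Rtrv (L ^ k) L M (R' k))

include hU hb hcoh

/-- **V-P CLOSED FOR THE LANDAU FORM ON THE TOWER's CARRIERS** (`hPc k`): part 10's rough Poincaré `qWV_le_nestLv` (A = 64, B = 40) + (GF3) `divControl_landauG` through
leaf-09-g6's `qWV_le_of_poincare_divControl`; smallness `80·d·((L^k)²a_k) ≤ 1` (+ part 10's two); `C_P,k = max(80(1+δ), 64 + 80·(d((L^k)²a_k)·64))`. [folklore] -/
theorem hPc_landau_nestLv (hM2 : ∀ μ, 1 < M μ) (k : ℕ) {a : ℝ} (ha0 : 0 ≤ a)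
    (ha : ∀ x κ ι, ‖Rlev L M R' k x κ * Rlev L M R' k (x + unitVec (fine (L ^ k) M) κ) ι - Rlev L M R' k x ι * Rlev L M R' k (x + unitVec (fine (L ^ k) M) ι) κ‖ ≤ a)
    (hsmall : 2 * (d : ℝ) * ((((L ^ k : ℕ) : ℝ)) * (((d - 1 : ℕ) : ℝ) * ((L ^ k - 1 : ℕ) : ℝ) * a)) ^ 2 ≤ 1 / 2)
    (hγs : 64 * (∑ q ∈ Finset.range k, ((((d - 1 : ℕ) : ℝ) + (d : ℝ) * d) * (((L : ℝ) * ((L ^ q - 1 : ℕ) : ℝ) * ((L - 1 : ℕ) : ℝ)) * b q))) ^ 2 ≤ 1)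
    (hsmall80 : 2 * 40 * ((d : ℝ) * ((((L ^ k : ℕ) : ℝ)) ^ 2 * a)) ≤ 1) {δ : ℝ} (hδ : 0 < δ) (W : Tor (fine (L ^ k) M) → Fin d → H) :
    qWV (L ^ k) M W ≤ max (40 * (2 * (1 + δ))) (64 + 40 * (2 * (0 + d * ((((L ^ k : ℕ) : ℝ)) ^ 2 * a) * 64)))
      * (ScV (L ^ k) M (Rlev L M R' k) (landauG (fine (L ^ k) M) δ (Rlev L M R' k)) W + nsqV M (QvL (L ^ k) M (nestLv L M R' k) W)) := by
  have hUk : ∀ x μ, Rlev L M R' k x μ ∈ unitary (H →L[ℂ] H) := Rlev_mem_unitary L M hU k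
  have hP := qWV_le_nestLv L M hU hb hcoh hM2 k ha hsmall hγs
  have h := qWV_le_of_poincare_divControl (L ^ k) M hUk ha0 (fun x μ ν => ha x μ ν) (landauG_nonneg hδ.le _)
    (Q := QvL (L ^ k) M (nestLv L M R' k)) (divControl_landauG (L ^ k) M (Rlev L M R' k) hδ (QvL (L ^ k) M (nestLv L M R' k)))
    (by norm_num : (0 : ℝ) ≤ 40) (fun W => by simpa only [Nat.cast_pow] using hP W) (by simpa only [Nat.cast_pow] using hsmall80) W
  simpa only [Nat.cast_pow] using h

/-- **V-P CLOSED FOR THE LANDAU FORM, FINE LEVEL** (`hPf k`): `hPc (k+1)` transported (`hPf_of_hPc_transport`, `landauG_hGtr`). [folklore] -/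
theorem hPf_landau_nestLv (hM2 : ∀ μ, 1 < M μ) (k : ℕ) {a : ℝ} (ha0 : 0 ≤ a)
    (ha : ∀ x κ ι, ‖Rlev L M R' (k + 1) x κ * Rlev L M R' (k + 1) (x + unitVec (fine (L ^ (k + 1)) M) κ) ι
      - Rlev L M R' (k + 1) x ι * Rlev L M R' (k + 1) (x + unitVec (fine (L ^ (k + 1)) M) ι) κ‖ ≤ a)
    (hsmall : 2 * (d : ℝ) * ((((L ^ (k + 1) : ℕ) : ℝ)) * (((d - 1 : ℕ) : ℝ) * ((L ^ (k + 1) - 1 : ℕ) : ℝ) * a)) ^ 2 ≤ 1 / 2)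
    (hγs : 64 * (∑ q ∈ Finset.range (k + 1), ((((d - 1 : ℕ) : ℝ) + (d : ℝ) * d) * (((L : ℝ) * ((L ^ q - 1 : ℕ) : ℝ) * ((L - 1 : ℕ) : ℝ)) * b q))) ^ 2 ≤ 1)
    (hsmall80 : 2 * 40 * ((d : ℝ) * ((((L ^ (k + 1) : ℕ) : ℝ)) ^ 2 * a)) ≤ 1) {δ : ℝ} (hδ : 0 < δ) (W' : Tor (fine L (fine (L ^ k) M)) → Fin d → H) :
    qVV (L ^ k) L M W' ≤ max (40 * (2 * (1 + δ))) (64 + 40 * (2 * (0 + d * ((((L ^ (k + 1) : ℕ) : ℝ)) ^ 2 * a) * 64)))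
      * (SfV (L ^ k) L M (R' k) (landauG (fine L (fine (L ^ k) M)) δ (R' k)) W'
        + nsqV M (QvL (L ^ k) M (nestLv L M R' k) (QvL L (fine (L ^ k) M) (lineT L (fine (L ^ k) M) (taxiTv L (fine (L ^ k) M) (R' k)) (R' k)) W'))) := by
  have h := hPc_landau_nestLv L M hU hb hcoh hM2 (k + 1) ha0 ha hsmall hγs hsmall80 hδ
  rw [landauG_hGtr L M (Rlev L M R') R' (fun k => rfl) δ k] at h
  exact hPf_of_hPc_transport (L ^ k) L M h W'

/-- **V-UB CLOSED FOR THE LANDAU FORM ON THE TOWER's CARRIERS** (`hUBc k`): part 10's `exists_ubV_nestLv_ScV` with (GF1′) := `landauG_le` (`C_G = d∕δ`, `C₀ = 0`). [folklore] -/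
theorem hUBc_landau_nestLv (hd : 1 ≤ d) (k : ℕ) {a : ℝ} (ha0 : 0 ≤ a)
    (ha : ∀ x κ ι, ‖Rlev L M R' k x κ * Rlev L M R' k (x + unitVec (fine (L ^ k) M) κ) ι - Rlev L M R' k x ι * Rlev L M R' k (x + unitVec (fine (L ^ k) M) ι) κ‖ ≤ a)
    (hc : (kappaV d (L ^ k))⁻¹ * ((∑ q ∈ Finset.range k, ((((d - 1 : ℕ) : ℝ) + (d : ℝ) * d) * (((L : ℝ) * ((L ^ q - 1 : ℕ) : ℝ) * ((L - 1 : ℕ) : ℝ)) * b q)))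
        + 3 * (((d - 1 : ℕ) : ℝ) * (L ^ k : ℕ) * ((L ^ k - 1 : ℕ) : ℝ) * a)) < 1) {δ : ℝ} (hδ : 0 < δ) (φ : Tor M → Fin d → H) :
    ∃ W : Tor (fine (L ^ k) M) → Fin d → H, QvL (L ^ k) M (nestLv L M R' k) W = φ ∧
      ScV (L ^ k) M (Rlev L M R' k) (landauG (fine (L ^ k) M) δ (Rlev L M R' k)) W
        ≤ lamV d ((L ^ k : ℕ) * (((d - 1 : ℕ) : ℝ) * ((L ^ k - 1 : ℕ) : ℝ) * a)) (d / δ) (((L ^ k : ℕ) : ℝ) ^ 2 * 0)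
          / (1 - (kappaV d (L ^ k))⁻¹ * ((∑ q ∈ Finset.range k, ((((d - 1 : ℕ) : ℝ) + (d : ℝ) * d) * (((L : ℝ) * ((L ^ q - 1 : ℕ) : ℝ) * ((L - 1 : ℕ) : ℝ)) * b q)))
              + 3 * (((d - 1 : ℕ) : ℝ) * (L ^ k : ℕ) * ((L ^ k - 1 : ℕ) : ℝ) * a))) ^ 2 * nsqV M φ :=
  exists_ubV_nestLv_ScV L M hU hb hcoh k ha0 ha hd hc (by positivity) le_rfl (landauG_le (L ^ k) M (Rlev_mem_unitary L M hU k) hδ) φ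

/-- **V-UB CLOSED FOR THE LANDAU FORM, FINE LEVEL** (`hUBf k`): `hUBc (k+1)` transported (part 1's `exists_ubV_nestLv_SfV`, `landauG_hGtr`). [folklore] -/
theorem hUBf_landau_nestLv (hd : 1 ≤ d) (k : ℕ) {a : ℝ} (ha0 : 0 ≤ a)
    (ha : ∀ x κ ι, ‖Rlev L M R' (k + 1) x κ * Rlev L M R' (k + 1) (x + unitVec (fine (L ^ (k + 1)) M) κ) ι
      - Rlev L M R' (k + 1) x ι * Rlev L M R' (k + 1) (x + unitVec (fine (L ^ (k + 1)) M) ι) κ‖ ≤ a)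
    (hc : (kappaV d (L ^ (k + 1)))⁻¹ * ((∑ q ∈ Finset.range (k + 1), ((((d - 1 : ℕ) : ℝ) + (d : ℝ) * d) * (((L : ℝ) * ((L ^ q - 1 : ℕ) : ℝ) * ((L - 1 : ℕ) : ℝ)) * b q)))
        + 3 * (((d - 1 : ℕ) : ℝ) * (L ^ (k + 1) : ℕ) * ((L ^ (k + 1) - 1 : ℕ) : ℝ) * a)) < 1) {δ : ℝ} (hδ : 0 < δ) (φ : Tor M → Fin d → H) :
    ∃ W' : Tor (fine L (fine (L ^ k) M)) → Fin d → H,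
      QvL (L ^ k) M (nestLv L M R' k) (QvL L (fine (L ^ k) M) (lineT L (fine (L ^ k) M) (taxiTv L (fine (L ^ k) M) (R' k)) (R' k)) W') = φ ∧
      SfV (L ^ k) L M (R' k) (landauG (fine L (fine (L ^ k) M)) δ (R' k)) W'
        ≤ lamV d ((L ^ (k + 1) : ℕ) * (((d - 1 : ℕ) : ℝ) * ((L ^ (k + 1) - 1 : ℕ) : ℝ) * a)) (d / δ) (((L ^ (k + 1) : ℕ) : ℝ) ^ 2 * 0)
          / (1 - (kappaV d (L ^ (k + 1)))⁻¹ * ((∑ q ∈ Finset.range (k + 1), ((((d - 1 : ℕ) : ℝ) + (d : ℝ) * d) * (((L : ℝ) * ((L ^ q - 1 : ℕ) : ℝ) * ((L - 1 : ℕ) : ℝ)) * b q)))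
              + 3 * (((d - 1 : ℕ) : ℝ) * (L ^ (k + 1) : ℕ) * ((L ^ (k + 1) - 1 : ℕ) : ℝ) * a))) ^ 2 * nsqV M φ := by
  have hG : ∀ W, Gtr (L ^ k) L M (landauG (fine L (fine (L ^ k) M)) δ (R' k)) W
      ≤ d / δ * roughV (L ^ (k + 1)) M (Rlev L M R' (k + 1)) W + 0 * nsqV (fine (L ^ (k + 1)) M) W := fun W => by
    rw [← landauG_hGtr L M (Rlev L M R') R' (fun k => rfl) δ k]
    exact landauG_le (L ^ (k + 1)) M (Rlev_mem_unitary L M hU (k + 1)) hδ W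
  exact exists_ubV_nestLv_SfV L M hU hb hcoh hd k ha0 ha hc (by positivity) le_rfl hG φ

end Sockets

/-! ## §2 THE LANDAU INHABITANT AT TAXI DATA UNDER THE PLAQUETTE CLASS -/

section End

variable (L : ℕ) [NeZero L] (M : Fin d → ℕ) [hM : ∀ μ, NeZero (M μ)]
variable {R' : (k : ℕ) → Tor (fine L (fine (L ^ k) M)) → Fin d → (ℂ →L[ℂ] ℂ)}

/-- **THE LANDAU-FAMILY VECTOR END AT BAŁABAN's TAXI DATA UNDER THE SCALE-INVARIANT PLAQUETTE CLASS.**  leaf-10-g3's `towerLimitRate_effV_of_leaves_landau` (p220989) at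
`T k := nestLv k`, `R k := Rlev k`, `T′ k := lineT (taxiTv (R′ k)) (R′ k)` for a COHERENT tower of UNITARY one-step bond operators with `(L^{k+1})²b_k ≤ c`, `c` polynomially
small (part 2's three conditions + `80·d·c ≤ 1`), `2 ≤ L`, `1 ≤ d`, `1 < M_μ`, `0 < δ`: `hTcomp`∕`hRtr` (rfl), `hsurj₁`, V-UB (`hUBc`∕`hUBf`, `Λ⋆ = 4·lamV d ((d−1)c) (d∕δ) 0`), V-P
(`hPc`∕`hPf`, `C_P⋆ = max(80(1+δ), 64 + 5120·d·c)`) ALL DISCHARGED; DISPLAYED: `hFED k` ∕ `hONE k` for the FULL Landau forms (NOT expected to be inhabited — N-ne2leaf01g6-1)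
and `hREG k`; rate any `θ ∈ [0,1)` (the displayed small parameters carry it).  [folklore] -/
theorem towerLimitRate_effV_taxiTower_landau_of_class (hL : 2 ≤ L) (hd : 1 ≤ d) (hM2 : ∀ μ, 1 < M μ) {δ : ℝ} (hδ : 0 < δ)
    -- the one-step bond data: unitary, plaquette class, coherent
    (hU : ∀ k x μ, R' k x μ ∈ unitary (ℂ →L[ℂ] ℂ)) {b : ℕ → ℝ} {c : ℝ}
    (hb : ∀ k x κ ι, ‖R' k x κ * R' k (x + unitVec (fine L (fine (L ^ k) M)) κ) ι - R' k x ι * R' k (x + unitVec (fine L (fine (L ^ k) M)) ι) κ‖ ≤ b k)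
    (hbc : ∀ k, (((L ^ (k + 1) : ℕ)) : ℝ) ^ 2 * b k ≤ c)
    (hcoh : ∀ k, coarseTv L (fine (L ^ (k + 1)) M) (R' (k + 1)) = Rtrv (L ^ k) L M (R' k))
    -- the polynomial smallness of the class constant
    (hsm1 : 60 * (6 : ℝ) ^ (d - 1) * ((2 * ((((d - 1 : ℕ) : ℝ) + (d : ℝ) * d)) + 3 * ((d - 1 : ℕ) : ℝ)) * c) ≤ 1 / 2)
    (hsm2 : 2 * (d : ℝ) * ((((d - 1 : ℕ) : ℝ)) * c) ^ 2 ≤ 1 / 2) (hsm3 : 64 * (2 * ((((d - 1 : ℕ) : ℝ) + (d : ℝ) * d) * c)) ^ 2 ≤ 1)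
    (hsm4 : 80 * ((d : ℝ) * c) ≤ 1)
    -- rate and the DISPLAYED leaves: full-form Federbush, full-fine-form V-ONE, V-REG
    {aa : ℝ} (haa : 0 < aa) {θ : ℝ} (hθ : 0 ≤ θ) (hθ1 : θ < 1)
    (CR δF ε₁ δ' : ℕ → ℝ) {CRs cδF cε cδ' : ℝ} (hCR : ∀ k, 0 ≤ CR k) (hCRs : ∀ k, CR k ≤ CRs) (hδF : ∀ k, 0 ≤ δF k) (hε₁ : ∀ k, 0 ≤ ε₁ k)
    (hδ' : ∀ k, 0 ≤ δ' k) (hδFθ : ∀ k, δF k ≤ cδF * θ ^ k) (hεθ : ∀ k, ε₁ k ≤ cε * θ ^ k) (hδ'θ : ∀ k, δ' k ≤ cδ' * θ ^ k)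
    {ρV : (k : ℕ) → (Tor (fine (L ^ k) M) → Fin d → ℂ) → ℝ} (hρ0 : ∀ k W, 0 ≤ ρV k W)
    (hFED : ∀ k W', ScV (L ^ k) M (Rlev L M R' k) (landauG (fine (L ^ k) M) δ (Rlev L M R' k))
        (QvL L (fine (L ^ k) M) (lineT L (fine (L ^ k) M) (taxiTv L (fine (L ^ k) M) (R' k)) (R' k)) W')
      ≤ (Real.sqrt (SfV (L ^ k) L M (R' k) (landauG (fine L (fine (L ^ k) M)) δ (R' k)) W') + δF k * Real.sqrt (qVV (L ^ k) L M W')) ^ 2)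
    (hONE : ∀ k W, blockSpin (QvL L (fine (L ^ k) M) (lineT L (fine (L ^ k) M) (taxiTv L (fine (L ^ k) M) (R' k)) (R' k)))
        (SfV (L ^ k) L M (R' k) (landauG (fine L (fine (L ^ k) M)) δ (R' k))) W
      ≤ (Real.sqrt (ScV (L ^ k) M (Rlev L M R' k) (landauG (fine (L ^ k) M) δ (Rlev L M R' k)) W + ε₁ k * ρV k W) + δ' k * Real.sqrt (qWV (L ^ k) M W)) ^ 2)
    (hREG : ∀ k (φ : Tor M → Fin d → ℂ) W, QvL (L ^ k) M (nestLv L M R' k) W = φ →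
      (∀ W₂, QvL (L ^ k) M (nestLv L M R' k) W₂ = φ →
        ScV (L ^ k) M (Rlev L M R' k) (landauG (fine (L ^ k) M) δ (Rlev L M R' k)) W ≤ ScV (L ^ k) M (Rlev L M R' k) (landauG (fine (L ^ k) M) δ (Rlev L M R' k)) W₂) →
      ρV k W ≤ CR k * (ScV (L ^ k) M (Rlev L M R' k) (landauG (fine (L ^ k) M) δ (Rlev L M R' k)) W + nsqV M φ)) :
    TowerLimitRate (ι := fun _ => Tor M × Fin d) (fun _ => (1 : Matrix (Tor M × Fin d) (Tor M × Fin d) ℂ)) 1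
      (fun k => effV (L ^ k) M (Rlev L M R' k) (KLandau (fine (L ^ k) M) δ (Rlev L M R' k)) (QmL (L ^ k) M (nestLv L M R' k)) aa)
      (eV (4 * lamV d (((d - 1 : ℕ) : ℝ) * c) (d / δ) 0) (max (40 * (2 * (1 + δ))) (64 + 5120 * ((d : ℝ) * c))) cδF
        + ePV (4 * lamV d (((d - 1 : ℕ) : ℝ) * c) (d / δ) 0) (max (40 * (2 * (1 + δ))) (64 + 5120 * ((d : ℝ) * c))) CRs cε cδ') θ := by
  have hL2 : (2 : ℝ) ≤ L := by exact_mod_cast hL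
  have hR' : ∀ k x μ, ‖R' k x μ‖ ≤ 1 := fun k x μ => norm_le_one_of_mem_unitary (hU k x μ)
  have hb0 : ∀ k, 0 ≤ b k := fun k => (norm_nonneg _).trans (hb k 0 ⟨0, hd⟩ ⟨0, hd⟩)
  have hc0 : 0 ≤ c := le_trans (by have := hb0 0; positivity) (hbc 0)
  -- the level-`k` plaquette defects in the same class (part 10 §1b)
  obtain ⟨a, ha0, ha, hac⟩ : ∃ a : ℕ → ℝ, (∀ k, 0 ≤ a k) ∧
      (∀ k x κ ι, ‖Rlev L M R' k x κ * Rlev L M R' k (x + unitVec (fine (L ^ k) M) κ) ι - Rlev L M R' k x ι * Rlev L M R' k (x + unitVec (fine (L ^ k) M) ι) κ‖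
        ≤ a k) ∧ (∀ k, (((L ^ k : ℕ)) : ℝ) ^ 2 * a k ≤ c) := by
    refine ⟨fun k => Nat.rec ((L : ℝ) * L * b 0) (fun q _ => b q) k, ?_, ?_, ?_⟩
    · rintro (_ | q)
      · exact (by have := hb0 0; positivity : 0 ≤ (L : ℝ) * L * b 0)
      · exact hb0 q
    · rintro (_ | q) x κ ι
      · exact Rlev_plaq_zero L M hb (hR' 0) x κ ι
      · exact Rlev_plaq_succ L M hb q x κ ι
    · rintro (_ | q)
      · have h := hbc 0
        simp only [zero_add, pow_one] at h
        show (((L ^ 0 : ℕ)) : ℝ) ^ 2 * ((L : ℝ) * L * b 0) ≤ c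
        simp only [pow_zero, Nat.cast_one, one_pow, one_mul]
        nlinarith
      · exact hbc q
  -- the (E_k) sum, the level term, `κ⁻¹γ_k ≤ ½` (part 2's arithmetic)
  have hS := sumDefect_le_of_class (d := d) L hL hb0 hbc
  have hS0 : ∀ k, 0 ≤ ∑ q ∈ Finset.range k, ((((d - 1 : ℕ) : ℝ) + (d : ℝ) * d) * (((L : ℝ) * ((L ^ q - 1 : ℕ) : ℝ) * ((L - 1 : ℕ) : ℝ)) * b q)) :=
    fun k => Finset.sum_nonneg fun q _ => by have := hb0 q; positivity
  have hT : ∀ k, 3 * (((d - 1 : ℕ) : ℝ) * (L ^ k : ℕ) * ((L ^ k - 1 : ℕ) : ℝ) * a k) ≤ 3 * (((d - 1 : ℕ) : ℝ) * c) :=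
    fun k => levelDefect_le_of_class (d := d) L k (ha0 k) (hac k)
  have hT0 : ∀ k, 0 ≤ 3 * (((d - 1 : ℕ) : ℝ) * (L ^ k : ℕ) * ((L ^ k - 1 : ℕ) : ℝ) * a k) := fun k => by have := ha0 k; positivity
  have hLk : ∀ k : ℕ, 0 < L ^ k := fun k => pow_pos (by omega) k
  have hκγ : ∀ k, (kappaV d (L ^ k))⁻¹ * ((∑ q ∈ Finset.range k, ((((d - 1 : ℕ) : ℝ) + (d : ℝ) * d) * (((L : ℝ) * ((L ^ q - 1 : ℕ) : ℝ) * ((L - 1 : ℕ) : ℝ)) * b q)))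
      + 3 * (((d - 1 : ℕ) : ℝ) * (L ^ k : ℕ) * ((L ^ k - 1 : ℕ) : ℝ) * a k)) ≤ 1 / 2 := fun k => by
    have h1 := mul_le_mul (kappaV_inv_le (d := d) hd (hLk k)) (show _ ≤ (2 * ((((d - 1 : ℕ) : ℝ) + (d : ℝ) * d)) + 3 * ((d - 1 : ℕ) : ℝ)) * c by
      linarith [hS k, hT k]) (add_nonneg (hS0 k) (hT0 k)) (by positivity)
    linarith
  have hcUB : ∀ k, (kappaV d (L ^ k))⁻¹ * ((∑ q ∈ Finset.range k, ((((d - 1 : ℕ) : ℝ) + (d : ℝ) * d) * (((L : ℝ) * ((L ^ q - 1 : ℕ) : ℝ) * ((L - 1 : ℕ) : ℝ)) * b q)))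
      + 3 * (((d - 1 : ℕ) : ℝ) * (L ^ k : ℕ) * ((L ^ k - 1 : ℕ) : ℝ) * a k)) < 1 := fun k => lt_of_le_of_lt (hκγ k) (by norm_num)
  have hsmallP : ∀ k, 2 * (d : ℝ) * ((((L ^ k : ℕ) : ℝ)) * (((d - 1 : ℕ) : ℝ) * ((L ^ k - 1 : ℕ) : ℝ) * a k)) ^ 2 ≤ 1 / 2 := fun k => by
    have h := blockDefect_le_of_class (d := d) L k (ha0 k) (hac k)
    have h0 : 0 ≤ ((L ^ k : ℕ) : ℝ) * (((d - 1 : ℕ) : ℝ) * ((L ^ k - 1 : ℕ) : ℝ) * a k) := by have := ha0 k; positivity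
    have h2 := pow_le_pow_left₀ h0 h 2
    nlinarith [Nat.cast_nonneg (α := ℝ) d]
  have hγs : ∀ k, 64 * (∑ q ∈ Finset.range k, ((((d - 1 : ℕ) : ℝ) + (d : ℝ) * d) * (((L : ℝ) * ((L ^ q - 1 : ℕ) : ℝ) * ((L - 1 : ℕ) : ℝ)) * b q))) ^ 2 ≤ 1 :=
    fun k => by have h2 := pow_le_pow_left₀ (hS0 k) (hS k) 2; linarith
  have hsmall80 : ∀ k, 2 * 40 * ((d : ℝ) * ((((L ^ k : ℕ) : ℝ)) ^ 2 * a k)) ≤ 1 := fun k => by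
    nlinarith [mul_le_mul_of_nonneg_left (hac k) (Nat.cast_nonneg (α := ℝ) d)]
  -- the one-step smallness at level `L` (as in part 2)
  have hc1 : ∀ k, (kappaV d L)⁻¹ * (3 * (((d - 1 : ℕ) : ℝ) * L * ((L - 1 : ℕ) : ℝ) * b k)) < 1 := fun k => by
    have hLm : ((L - 1 : ℕ) : ℝ) ≤ L := by rw [Nat.cast_sub (by omega), Nat.cast_one]; linarith
    have h2 : (L : ℝ) * L * b k ≤ c := by
      have : (L : ℝ) * L ≤ (((L ^ (k + 1) : ℕ)) : ℝ) ^ 2 := by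
        push_cast
        have : (L : ℝ) ≤ (L : ℝ) ^ (k + 1) := le_self_pow₀ (by linarith) (by omega)
        nlinarith
      linarith [mul_le_mul_of_nonneg_right this (hb0 k), hbc k]
    have h1 : (L : ℝ) * ((L - 1 : ℕ) : ℝ) * b k ≤ c := by
      nlinarith [mul_le_mul_of_nonneg_left hLm (by have := hb0 k; positivity : 0 ≤ (L : ℝ) * b k)]
    have h5 : 3 * (((d - 1 : ℕ) : ℝ) * L * ((L - 1 : ℕ) : ℝ) * b k) ≤ (2 * ((((d - 1 : ℕ) : ℝ) + (d : ℝ) * d)) + 3 * ((d - 1 : ℕ) : ℝ)) * c := by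
      nlinarith [mul_le_mul_of_nonneg_left h1 (Nat.cast_nonneg (α := ℝ) (d - 1)), Nat.cast_nonneg (α := ℝ) (d - 1), Nat.cast_nonneg (α := ℝ) d]
    have h7 := mul_le_mul (kappaV_inv_le (d := d) hd (show 0 < L by omega)) h5 (by have := hb0 k; positivity) (by positivity)
    linarith
  -- uniform constants
  set Λs : ℝ := 4 * lamV d (((d - 1 : ℕ) : ℝ) * c) (d / δ) 0 with hΛsdef
  set CPs : ℝ := max (40 * (2 * (1 + δ))) (64 + 5120 * ((d : ℝ) * c)) with hCPsdef
  have hΛk : ∀ k, lamV d ((L ^ k : ℕ) * (((d - 1 : ℕ) : ℝ) * ((L ^ k - 1 : ℕ) : ℝ) * a k)) (d / δ) (((L ^ k : ℕ) : ℝ) ^ 2 * 0)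
      / (1 - (kappaV d (L ^ k))⁻¹ * ((∑ q ∈ Finset.range k, ((((d - 1 : ℕ) : ℝ) + (d : ℝ) * d) * (((L : ℝ) * ((L ^ q - 1 : ℕ) : ℝ) * ((L - 1 : ℕ) : ℝ)) * b q)))
          + 3 * (((d - 1 : ℕ) : ℝ) * (L ^ k : ℕ) * ((L ^ k - 1 : ℕ) : ℝ) * a k))) ^ 2 ≤ Λs := fun k =>
    LambdaV_le_of_class (d := d) (by have := ha0 k; positivity) (blockDefect_le_of_class (d := d) L k (ha0 k) (hac k)) (by positivity) le_rfl
      (by positivity) (by simp) (hκγ k)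
  have hΛs0 : 0 ≤ Λs := by have := lamV_nonneg (d := d) (x := ((d - 1 : ℕ) : ℝ) * c) (CG := d / δ) (c₀ := 0) (by positivity) le_rfl; positivity
  have hCPk : ∀ k, max (40 * (2 * (1 + δ))) (64 + 40 * (2 * (0 + d * ((((L ^ k : ℕ) : ℝ)) ^ 2 * a k) * 64))) ≤ CPs := fun k =>
    max_le_max le_rfl (by nlinarith [mul_le_mul_of_nonneg_left (hac k) (Nat.cast_nonneg (α := ℝ) d)])
  have hCPs0 : 0 ≤ CPs := le_max_of_le_left (by positivity)
  have hLG0 : ∀ k W, 0 ≤ ScV (L ^ k) M (Rlev L M R' k) (landauG (fine (L ^ k) M) δ (Rlev L M R' k)) W :=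
    fun k W => ScV_nonneg (L ^ k) M _ (landauG_nonneg hδ.le _) W
  refine towerLimitRate_effV_of_leaves_landau L M (Rlev L M R') R' (nestLv L M R')
    (fun k => lineT L (fine (L ^ k) M) (taxiTv L (fine (L ^ k) M) (R' k)) (R' k)) hδ (fun k => rfl) (fun k => rfl)
    (fun k => surjective_QvL_taxi (L ^ k) L M (hU k) (hb0 k) (hb k) hd (hc1 k)) haa
    (fun _ => Λs) (fun _ => CPs) CR δF ε₁ δ' (fun _ => hΛs0) (fun _ => le_rfl) (fun _ => hCPs0) (fun _ => le_rfl) hCR hCRs hδF hε₁ hδ' hθ hθ1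
    hδFθ hεθ hδ'θ hρ0 (fun k φ => ?_) (fun k φ => ?_) (fun k W => ?_) (fun k W' => ?_) hFED hONE hREG
  · obtain ⟨W, hW, hS⟩ := hUBc_landau_nestLv L M hU hb hcoh hd k (ha0 k) (ha k) (hcUB k) hδ φ
    exact ⟨W, hW, hS.trans (mul_le_mul_of_nonneg_right (hΛk k) (nsqV_nonneg M φ))⟩
  · obtain ⟨W', hW', hS⟩ := hUBf_landau_nestLv L M hU hb hcoh hd k (ha0 (k + 1)) (ha (k + 1)) (hcUB (k + 1)) hδ φ
    exact ⟨W', hW', hS.trans (mul_le_mul_of_nonneg_right (hΛk (k + 1)) (nsqV_nonneg M φ))⟩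
  · have h := hPc_landau_nestLv L M hU hb hcoh hM2 k (ha0 k) (ha k) (hsmallP k) (hγs k) (hsmall80 k) hδ W
    exact h.trans (mul_le_mul_of_nonneg_right (hCPk k) (add_nonneg (hLG0 k W) (nsqV_nonneg M _)))
  · have h := hPf_landau_nestLv L M hU hb hcoh hM2 k (ha0 (k + 1)) (ha (k + 1)) (hsmallP (k + 1)) (hγs (k + 1)) (hsmall80 (k + 1)) hδ W'
    refine h.trans (mul_le_mul_of_nonneg_right (hCPk (k + 1)) (add_nonneg ?_ (nsqV_nonneg M _)))
    rw [SfV_eq_transport]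
    exact ScV_nonneg (L ^ k * L) M _ (fun W => by rw [VariationalVectorLandauTower.landauG_transport]; exact landauG_nonneg hδ.le _ _) _

end End

/-! ## §3 δ = 1: V-REG DISCHARGED as well (leaf-03-g5's near-line V-REG for the Feynman–Landau form) -/

section EndReg

variable (L : ℕ) [NeZero L] (M : Fin d → ℕ) [hM : ∀ μ, NeZero (M μ)]
variable {R' : (k : ℕ) → Tor (fine L (fine (L ^ k) M)) → Fin d → (ℂ →L[ℂ] ℂ)}

/-- **THE FEYNMAN–LANDAU (`δ = 1`) VECTOR END AT BAŁABAN's TAXI DATA, V-REG DISCHARGED TOO**: §2 at `δ = 1` with `ρV k := rhoV (L^k) M (Rlev k)` and the `hREG k` socket FED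
by leaf-03-g5's `VariationalVectorRegularityNear.hREG_rhoV_landau_near` (frames the STRAIGHT level-`k` taxi, `hnear` := gen 4's (E_k) `nestLv_sub_lineT_le`, V-UB := §1;
`C_R⋆ = 4Λ⋆ + ½`, `Λ⋆ = 4·lamV d ((d−1)c) d 0`).  DISPLAYED: ONLY `hFED k` ∕ `hONE k` for the FULL Landau forms — the two one-step-consistency binders of the gauge functional
(NOT expected to be inhabited for `landauG`, N-ne2leaf01g6-1).  [folklore] -/
theorem towerLimitRate_effV_taxiTower_landau_one_of_class (hL : 2 ≤ L) (hd : 1 ≤ d) (hM2 : ∀ μ, 1 < M μ)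
    -- the one-step bond data: unitary, plaquette class, coherent
    (hU : ∀ k x μ, R' k x μ ∈ unitary (ℂ →L[ℂ] ℂ)) {b : ℕ → ℝ} {c : ℝ}
    (hb : ∀ k x κ ι, ‖R' k x κ * R' k (x + unitVec (fine L (fine (L ^ k) M)) κ) ι - R' k x ι * R' k (x + unitVec (fine L (fine (L ^ k) M)) ι) κ‖ ≤ b k)
    (hbc : ∀ k, (((L ^ (k + 1) : ℕ)) : ℝ) ^ 2 * b k ≤ c)
    (hcoh : ∀ k, coarseTv L (fine (L ^ (k + 1)) M) (R' (k + 1)) = Rtrv (L ^ k) L M (R' k))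
    -- the polynomial smallness of the class constant
    (hsm1 : 60 * (6 : ℝ) ^ (d - 1) * ((2 * ((((d - 1 : ℕ) : ℝ) + (d : ℝ) * d)) + 3 * ((d - 1 : ℕ) : ℝ)) * c) ≤ 1 / 2)
    (hsm2 : 2 * (d : ℝ) * ((((d - 1 : ℕ) : ℝ)) * c) ^ 2 ≤ 1 / 2) (hsm3 : 64 * (2 * ((((d - 1 : ℕ) : ℝ) + (d : ℝ) * d) * c)) ^ 2 ≤ 1)
    (hsm4 : 80 * ((d : ℝ) * c) ≤ 1)
    -- rate and the two DISPLAYED one-step-consistency binders of the gauge functional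
    {aa : ℝ} (haa : 0 < aa) {θ : ℝ} (hθ : 0 ≤ θ) (hθ1 : θ < 1)
    (δF ε₁ δ' : ℕ → ℝ) {cδF cε cδ' : ℝ} (hδF : ∀ k, 0 ≤ δF k) (hε₁ : ∀ k, 0 ≤ ε₁ k) (hδ' : ∀ k, 0 ≤ δ' k)
    (hδFθ : ∀ k, δF k ≤ cδF * θ ^ k) (hεθ : ∀ k, ε₁ k ≤ cε * θ ^ k) (hδ'θ : ∀ k, δ' k ≤ cδ' * θ ^ k)
    (hFED : ∀ k W', ScV (L ^ k) M (Rlev L M R' k) (landauG (fine (L ^ k) M) 1 (Rlev L M R' k))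
        (QvL L (fine (L ^ k) M) (lineT L (fine (L ^ k) M) (taxiTv L (fine (L ^ k) M) (R' k)) (R' k)) W')
      ≤ (Real.sqrt (SfV (L ^ k) L M (R' k) (landauG (fine L (fine (L ^ k) M)) 1 (R' k)) W') + δF k * Real.sqrt (qVV (L ^ k) L M W')) ^ 2)
    (hONE : ∀ k W, blockSpin (QvL L (fine (L ^ k) M) (lineT L (fine (L ^ k) M) (taxiTv L (fine (L ^ k) M) (R' k)) (R' k)))
        (SfV (L ^ k) L M (R' k) (landauG (fine L (fine (L ^ k) M)) 1 (R' k))) W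
      ≤ (Real.sqrt (ScV (L ^ k) M (Rlev L M R' k) (landauG (fine (L ^ k) M) 1 (Rlev L M R' k)) W + ε₁ k * rhoV (L ^ k) M (Rlev L M R' k) W)
          + δ' k * Real.sqrt (qWV (L ^ k) M W)) ^ 2) :
    TowerLimitRate (ι := fun _ => Tor M × Fin d) (fun _ => (1 : Matrix (Tor M × Fin d) (Tor M × Fin d) ℂ)) 1
      (fun k => effV (L ^ k) M (Rlev L M R' k) (KLandau (fine (L ^ k) M) 1 (Rlev L M R' k)) (QmL (L ^ k) M (nestLv L M R' k)) aa)
      (eV (4 * lamV d (((d - 1 : ℕ) : ℝ) * c) (d / 1) 0) (max (40 * (2 * (1 + (1 : ℝ)))) (64 + 5120 * ((d : ℝ) * c))) cδF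
        + ePV (4 * lamV d (((d - 1 : ℕ) : ℝ) * c) (d / 1) 0) (max (40 * (2 * (1 + (1 : ℝ)))) (64 + 5120 * ((d : ℝ) * c)))
          (4 * (4 * lamV d (((d - 1 : ℕ) : ℝ) * c) (d / 1) 0) + 1 / 2) cε cδ') θ := by
  have hL2 : (2 : ℝ) ≤ L := by exact_mod_cast hL
  have hR' : ∀ k x μ, ‖R' k x μ‖ ≤ 1 := fun k x μ => norm_le_one_of_mem_unitary (hU k x μ)
  have hb0 : ∀ k, 0 ≤ b k := fun k => (norm_nonneg _).trans (hb k 0 ⟨0, hd⟩ ⟨0, hd⟩)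
  -- the level-`k` plaquette defects in the same class (part 10 §1b)
  obtain ⟨a, ha0, ha, hac⟩ : ∃ a : ℕ → ℝ, (∀ k, 0 ≤ a k) ∧
      (∀ k x κ ι, ‖Rlev L M R' k x κ * Rlev L M R' k (x + unitVec (fine (L ^ k) M) κ) ι - Rlev L M R' k x ι * Rlev L M R' k (x + unitVec (fine (L ^ k) M) ι) κ‖
        ≤ a k) ∧ (∀ k, (((L ^ k : ℕ)) : ℝ) ^ 2 * a k ≤ c) := by
    refine ⟨fun k => Nat.rec ((L : ℝ) * L * b 0) (fun q _ => b q) k, ?_, ?_, ?_⟩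
    · rintro (_ | q)
      · exact (by have := hb0 0; positivity : 0 ≤ (L : ℝ) * L * b 0)
      · exact hb0 q
    · rintro (_ | q) x κ ι
      · exact Rlev_plaq_zero L M hb (hR' 0) x κ ι
      · exact Rlev_plaq_succ L M hb q x κ ι
    · rintro (_ | q)
      · have h := hbc 0
        simp only [zero_add, pow_one] at h
        show (((L ^ 0 : ℕ)) : ℝ) ^ 2 * ((L : ℝ) * L * b 0) ≤ c
        simp only [pow_zero, Nat.cast_one, one_pow, one_mul]
        nlinarith
      · exact hbc q
  -- part 2's arithmetic: the (E_k) sum, the level term, `κ⁻¹γ_k ≤ ½`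
  have hS := sumDefect_le_of_class (d := d) L hL hb0 hbc
  have hS0 : ∀ k, 0 ≤ ∑ q ∈ Finset.range k, ((((d - 1 : ℕ) : ℝ) + (d : ℝ) * d) * (((L : ℝ) * ((L ^ q - 1 : ℕ) : ℝ) * ((L - 1 : ℕ) : ℝ)) * b q)) :=
    fun k => Finset.sum_nonneg fun q _ => by have := hb0 q; positivity
  have hT : ∀ k, 3 * (((d - 1 : ℕ) : ℝ) * (L ^ k : ℕ) * ((L ^ k - 1 : ℕ) : ℝ) * a k) ≤ 3 * (((d - 1 : ℕ) : ℝ) * c) :=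
    fun k => levelDefect_le_of_class (d := d) L k (ha0 k) (hac k)
  have hT0 : ∀ k, 0 ≤ 3 * (((d - 1 : ℕ) : ℝ) * (L ^ k : ℕ) * ((L ^ k - 1 : ℕ) : ℝ) * a k) := fun k => by have := ha0 k; positivity
  have hLk : ∀ k : ℕ, 0 < L ^ k := fun k => pow_pos (by omega) k
  have hκγ : ∀ k, (kappaV d (L ^ k))⁻¹ * ((∑ q ∈ Finset.range k, ((((d - 1 : ℕ) : ℝ) + (d : ℝ) * d) * (((L : ℝ) * ((L ^ q - 1 : ℕ) : ℝ) * ((L - 1 : ℕ) : ℝ)) * b q)))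
      + 3 * (((d - 1 : ℕ) : ℝ) * (L ^ k : ℕ) * ((L ^ k - 1 : ℕ) : ℝ) * a k)) ≤ 1 / 2 := fun k => by
    have h1 := mul_le_mul (kappaV_inv_le (d := d) hd (hLk k)) (show _ ≤ (2 * ((((d - 1 : ℕ) : ℝ) + (d : ℝ) * d)) + 3 * ((d - 1 : ℕ) : ℝ)) * c by
      linarith [hS k, hT k]) (add_nonneg (hS0 k) (hT0 k)) (by positivity)
    linarith
  have hcUB : ∀ k, (kappaV d (L ^ k))⁻¹ * ((∑ q ∈ Finset.range k, ((((d - 1 : ℕ) : ℝ) + (d : ℝ) * d) * (((L : ℝ) * ((L ^ q - 1 : ℕ) : ℝ) * ((L - 1 : ℕ) : ℝ)) * b q)))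
      + 3 * (((d - 1 : ℕ) : ℝ) * (L ^ k : ℕ) * ((L ^ k - 1 : ℕ) : ℝ) * a k)) < 1 := fun k => lt_of_le_of_lt (hκγ k) (by norm_num)
  have hsmallP : ∀ k, 2 * (d : ℝ) * ((((L ^ k : ℕ) : ℝ)) * (((d - 1 : ℕ) : ℝ) * ((L ^ k - 1 : ℕ) : ℝ) * a k)) ^ 2 ≤ 1 / 2 := fun k => by
    have h := blockDefect_le_of_class (d := d) L k (ha0 k) (hac k)
    have h0 : 0 ≤ ((L ^ k : ℕ) : ℝ) * (((d - 1 : ℕ) : ℝ) * ((L ^ k - 1 : ℕ) : ℝ) * a k) := by have := ha0 k; positivity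
    have h2 := pow_le_pow_left₀ h0 h 2
    nlinarith [Nat.cast_nonneg (α := ℝ) d]
  have hγs : ∀ k, 64 * (∑ q ∈ Finset.range k, ((((d - 1 : ℕ) : ℝ) + (d : ℝ) * d) * (((L : ℝ) * ((L ^ q - 1 : ℕ) : ℝ) * ((L - 1 : ℕ) : ℝ)) * b q))) ^ 2 ≤ 1 :=
    fun k => by have h2 := pow_le_pow_left₀ (hS0 k) (hS k) 2; linarith
  have hsmallp : ∀ k, 80 * ((d : ℝ) * ((((L ^ k : ℕ) : ℝ)) ^ 2 * a k)) ≤ 1 := fun k => by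
    nlinarith [mul_le_mul_of_nonneg_left (hac k) (Nat.cast_nonneg (α := ℝ) d)]
  -- the V-UB constant at δ = 1 and its uniform bound
  set Λs : ℝ := 4 * lamV d (((d - 1 : ℕ) : ℝ) * c) (d / 1) 0 with hΛsdef
  have hΛk : ∀ k, lamV d ((L ^ k : ℕ) * (((d - 1 : ℕ) : ℝ) * ((L ^ k - 1 : ℕ) : ℝ) * a k)) (d / 1) (((L ^ k : ℕ) : ℝ) ^ 2 * 0)
      / (1 - (kappaV d (L ^ k))⁻¹ * ((∑ q ∈ Finset.range k, ((((d - 1 : ℕ) : ℝ) + (d : ℝ) * d) * (((L : ℝ) * ((L ^ q - 1 : ℕ) : ℝ) * ((L - 1 : ℕ) : ℝ)) * b q)))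
          + 3 * (((d - 1 : ℕ) : ℝ) * (L ^ k : ℕ) * ((L ^ k - 1 : ℕ) : ℝ) * a k))) ^ 2 ≤ Λs := fun k =>
    LambdaV_le_of_class (d := d) (by have := ha0 k; positivity) (blockDefect_le_of_class (d := d) L k (ha0 k) (hac k)) (by positivity) le_rfl
      (by positivity) (by simp) (hκγ k)
  have hΛk0 : ∀ k, 0 ≤ lamV d ((L ^ k : ℕ) * (((d - 1 : ℕ) : ℝ) * ((L ^ k - 1 : ℕ) : ℝ) * a k)) (d / 1) (((L ^ k : ℕ) : ℝ) ^ 2 * 0)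
      / (1 - (kappaV d (L ^ k))⁻¹ * ((∑ q ∈ Finset.range k, ((((d - 1 : ℕ) : ℝ) + (d : ℝ) * d) * (((L : ℝ) * ((L ^ q - 1 : ℕ) : ℝ) * ((L - 1 : ℕ) : ℝ)) * b q)))
          + 3 * (((d - 1 : ℕ) : ℝ) * (L ^ k : ℕ) * ((L ^ k - 1 : ℕ) : ℝ) * a k))) ^ 2 :=
    fun k => div_nonneg (lamV_nonneg (by positivity) (by positivity)) (sq_nonneg _)
  -- V-REG at every level (leaf-03-g5's near-line V-REG; frames the straight level-`k` taxi, `hnear` := (E_k))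
  have hREG : ∀ k (φ : Tor M → Fin d → ℂ) W, QvL (L ^ k) M (nestLv L M R' k) W = φ →
      (∀ W₂, QvL (L ^ k) M (nestLv L M R' k) W₂ = φ →
        ScV (L ^ k) M (Rlev L M R' k) (landauG (fine (L ^ k) M) 1 (Rlev L M R' k)) W ≤ ScV (L ^ k) M (Rlev L M R' k) (landauG (fine (L ^ k) M) 1 (Rlev L M R' k)) W₂) →
      rhoV (L ^ k) M (Rlev L M R' k) W ≤ (4 * Λs + 1 / 2) * (ScV (L ^ k) M (Rlev L M R' k) (landauG (fine (L ^ k) M) 1 (Rlev L M R' k)) W + nsqV M φ) :=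
    fun k φ W hW hmin => by
    have hUk : ∀ x μ, Rlev L M R' k x μ ∈ unitary (ℂ →L[ℂ] ℂ) := Rlev_mem_unitary L M hU k
    have hw := inBlock_blockOf_of_bpt (L ^ k) M hM2
      (P := fun x μ => ‖Rlev L M R' k x μ * star (taxiTv (L ^ k) M (Rlev L M R' k) (x + unitVec (fine (L ^ k) M) μ)) * taxiTv (L ^ k) M (Rlev L M R' k) x - 1‖
        ≤ ((d - 1 : ℕ) : ℝ) * ((L ^ k - 1 : ℕ) : ℝ) * a k)
      (fun y j μ hj => inBlock_defect_taxiTv_adjoint_le (L ^ k) M hUk (ha k) y j μ hj)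
    have h := hREG_rhoV_landau_near (L ^ k) M hUk (taxiTv_mem_unitary (L ^ k) M hUk) hw (by simpa only [Nat.cast_pow] using hsmallP k) (ha0 k)
      (fun x μ ν => ha k x μ ν) (by simpa only [Nat.cast_pow] using hsmallp k) (norm_nestLv_le_one L M hR' k) (nestLv_sub_lineT_le L M hR' hb hcoh k) (hγs k)
      (hΛk0 k) (hUBc_landau_nestLv L M hU hb hcoh hd k (ha0 k) (ha k) (hcUB k) one_pos) φ W hW hmin
    have hS0' : 0 ≤ ScV (L ^ k) M (Rlev L M R' k) (landauG (fine (L ^ k) M) 1 (Rlev L M R' k)) W + nsqV M φ :=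
      add_nonneg (ScV_nonneg (L ^ k) M _ (landauG_nonneg zero_le_one _) W) (nsqV_nonneg M φ)
    exact h.trans (mul_le_mul_of_nonneg_right (by linarith [hΛk k]) hS0')
  have hΛs0 : 0 ≤ Λs := (hΛk0 0).trans (hΛk 0)
  exact towerLimitRate_effV_taxiTower_landau_of_class L M hL hd hM2 one_pos hU hb hbc hcoh hsm1 hsm2 hsm3 hsm4 haa hθ hθ1
    (fun _ => 4 * Λs + 1 / 2) δF ε₁ δ' (fun _ => by positivity) (fun _ => le_rfl) hδF hε₁ hδ' hδFθ hεθ hδ'θ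
    (fun k W => rhoV_nonneg (L ^ k) M _ W) hFED hONE hREG

end EndReg




end Summit.QuantumFields.BalabanUV.T4Continuum.VariationalColourTaxiTransport

end
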